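import Summits.HodgeConjecture.HodgeConjecture.Theses.NikulinTwinTransport
import Summits.HodgeConjecture.HodgeConjecture.Theorems.NikulinSerreCarrier.Negative.InvariantCarrierPinned
import Literature.AlgebraicGeometry.Surfaces.K3Surface
import Literature.AlgebraicGeometry.Surfaces.K3NikulinInvolution
import Literature.AlgebraicGeometry.HodgeTheory.AnalytifiedVectorBundle
import Literature.AlgebraicGeometry.HodgeTheory.KaehlerClassHodgeType
import Literature.AlgebraicGeometry.HodgeTheory.ChernCharacterBetti
import Literature.Geometry.Hyperkaehler.Hyperholomorphic
import Literature.AlgebraicGeometry.HodgeTheory.GysinBaseChangeOfKunneth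
import Literature.AlgebraicGeometry.HodgeTheory.ComplexGysinHodgeType
import Summits.HodgeConjecture.HodgeConjecture.Theorems.NikulinSerreCarrier.Negative.OrientationTwist

/-!
# Line `modular-twin-address` — crux `NikulinSerreCarrier` (stmt-HodgeConjecture-14464), route
# NikulinTwinTransport: the stub `stub_mixedClassTransfer` (mixed-class transfer) and its Gysin helpers

Registered stub of the checked skeleton `Lines/modular-twin-address.lean` (v3), proved with EXACTLY its
registered signature (`--supports stmt-HodgeConjecture-14464`): from the address equation
`g^*(snd_*(fst^*(Ψ y) ∪ ch₂ 𝓔)) = (−2m) • y` on `H²(Y)` (`m ∈ ℂ ∖ 0`), the bijective 2-similitude `Ψ` and the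
Künneth spanning hypothesis `hK` (verbatim that of `gysin_baseChange_of_kunneth`; the stub
`stub_kunnethSpanning`), the class `ch₂((X ◁ g)^*𝓔) = (X ◁ g)^* ch₂ 𝓔` (`ChernCharacterBetti.map_ch`) acts on
`H²(Y)` as `fst_*(snd^* y ∪ ch₂) = (−m′) • Ψ y`, `m′ ≠ 0`.  Helpers (namespace
`…Theorems.NikulinTwinTransport.MixedClassTransfer`; general Gysin formalism for the tree's constructed
`complexGysin μ`, modelled on `HodgeTheory/GysinBaseChangeOfKunneth`): non-vanishing of the fibre integral
over `X`; **base change** for the cartesian square `X ⊗ Y —(X ◁ g)→ X ⊗ M` over `g : Y ⟶ M`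
(`g^* ∘ snd_* = c • snd_* ∘ (X ◁ g)^*`); the **transpose of a correspondence**
(`⟨fst_*(snd^* y ∪ γ) ∪ x, [X]⟩ = ⟨y ∪ snd_*(fst^* x ∪ γ), [Y]⟩`).  Stub: base change turns the address
equation into `c • B′(Ψ w) = (−2m) • w` on `X ⊗ Y` (`c = 0` forces `H²(Y) = 0`); `A = [ch₂′]_*` is the
transpose of `B′`, so `⟨A y ∪ Ψ w⟩ = −(2m/c) a e_Y`, `⟨Ψ y ∪ Ψ w⟩ = 2a e_X` (`y ∪ w = a p_Y`; `e_X = ⟨p_X,[X]⟩`,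
`e_Y = ⟨p_Y,[Y]⟩` non-zero), whence `A y = −m′ Ψ y`, `m′ = m e_Y/(c e_X)`, by perfectness of the cup
pairing.  No named facts are used.

## References

* [Fulton1998] W. Fulton, Intersection Theory, 2nd ed., Springer 1998, Prop. 1.7, §16.1.
* [FultonYoungTableaux1997] W. Fulton, Young Tableaux, CUP 1997, Appendix B §B.1 (3)–(6).
* [HatcherAT2002] A. Hatcher, Algebraic Topology, CUP 2002, §3.1–§3.3 (Thm. 3.2, 3.11, 3.15, 3.26, Prop. 3.38).
-/

noncomputable section

open CategoryTheory MonoidalCategory CartesianMonoidalCategory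
open Literature.AlgebraicGeometry.Motives Literature.AlgebraicGeometry.HodgeTheory
open Literature.AlgebraicTopology.SingularHomology

namespace Summit.HodgeConjecture.HodgeConjecture.Theorems.NikulinTwinTransport.MixedClassTransfer

universe u

variable {l m n : ℕ} {X Y M : SchemeOver ℂ}

/-- **A non-zero top-degree class pairs non-trivially with `[X(ℂ)]`** (`H₂ₙ(X(ℂ); ℂ) = ℂ · [X(ℂ)]`,
Hatcher Thm. 3.26, and `H²ⁿ ↪ Hom(H₂ₙ, ℂ)`, Thm. 3.2). [cite: HatcherAT2002, §3.1 Thm. 3.2 and §3.3 Thm. 3.26] -/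
theorem kroneckerPairing_fundamentalClass_ne_zero (μ : OrientationFamily) (hX : IsSmoothProjective n X)
    {p : complexBetti X (2 * n)} (hp : p ≠ 0) :
    kroneckerPairing ℂ ℂ (ComplexPoints X) (2 * n) p (μ hX).fundamentalClass ≠ 0 := by
  letI := hX.chartedSpace; haveI := ComplexPoints.compactSpace_of_isSmoothProjective hX
  haveI := ComplexPoints.t2Space_of_isSmoothProjective hX; haveI := connectedSpace_complexPoints hX
  intro h
  apply hp
  apply kroneckerPairing_injective_of_field ℂ (ComplexPoints X) (2 * n)
  rw [map_zero]
  refine LinearMap.ext fun z ↦ ?_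
  obtain ⟨r, rfl⟩ := exists_eq_smul_fundamentalClass_of_connectedSpace (μ hX) z
  rw [map_smul, h, smul_zero, LinearMap.zero_apply]

/-- **For some `a ∈ H^{2l}(X(ℂ))`, `(snd_{X,Y})_* (fst_{X,Y}^* a) ≠ 0` in `H⁰(Y(ℂ))`**, GRANTED Künneth
spanning in the top degree of `X ⊗ Y`: some top class pairs non-trivially with `[(X ⊗ Y)(ℂ)] ≠ 0`, hence
so does a cross product `fst^* a ∪ snd^* w` (`deg a = 2l`), and `⟨fst^* a ∪ snd^* w, [X ⊗ Y]⟩ =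
⟨snd_* fst^* a ∪ w, [Y]⟩` (`cupPairing_gysinMap`). [cite: HatcherAT2002, §3.2 Thm. 3.15 and §3.1 Thm. 3.2]
[cite: FultonYoungTableaux1997, Appendix B §B.1 (5)–(6)] -/
theorem exists_gysin_snd_map_fst_ne_zero (μ : OrientationFamily)
    (hX : IsSmoothProjective l X) (hY : IsSmoothProjective m Y)
    (hKXY : ∀ z : complexBetti (X ⊗ Y) (2 * (l + m)), z ∈ Submodule.span ℂ
      {v | ∃ (i j : ℕ) (h : i + j = 2 * (l + m)) (a : complexBetti X i) (w : complexBetti Y j),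
        v = cupProduct h (complexBetti.map (fst X Y) i a) (complexBetti.map (snd X Y) j w)}) :
    ∃ a : complexBetti X (2 * l),
      complexGysin μ (IsSmoothProjective.tensor_holds hX hY) hY (snd X Y)
        (show 2 * l + 2 * m = 0 + 2 * (l + m) by omega)
        (complexBetti.map (fst X Y) (2 * l) a) ≠ 0 := by
  have hμ : μ.HasPoincareDuality := OrientationFamily.hasPoincareDuality μ
  have hXY := IsSmoothProjective.tensor_holds hX hY
  letI := hXY.chartedSpace; haveI := ComplexPoints.compactSpace_of_isSmoothProjective hXY
  haveI := ComplexPoints.t2Space_of_isSmoothProjective hXY; haveI := connectedSpace_complexPoints hXY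
  set κ := kroneckerPairing ℂ ℂ (ComplexPoints (X ⊗ Y)) (2 * (l + m)) with hκ
  obtain ⟨G₀, hG₀ne⟩ : ∃ G₀, κ G₀ (μ hXY).fundamentalClass ≠ 0 := by
    by_contra! h
    refine fundamentalClass_ne_zero (μ hXY) ((Module.forall_dual_apply_eq_zero_iff ℂ _).1 fun φ ↦ ?_)
    obtain ⟨G, rfl⟩ := kroneckerPairing_surjective ℂ (ComplexPoints (X ⊗ Y)) (2 * (l + m)) φ
    exact h G
  by_contra hall
  push Not at hall
  apply hG₀ne
  -- the pairing with `[X ⊗ Y]` kills every cross product, hence everything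
  have hle : Submodule.span ℂ {v | ∃ (i j : ℕ) (h : i + j = 2 * (l + m)) (a : complexBetti X i)
        (w : complexBetti Y j),
        v = cupProduct h (complexBetti.map (fst X Y) i a) (complexBetti.map (snd X Y) j w)} ≤
      LinearMap.ker (κ.flip (μ hXY).fundamentalClass) := by
    refine Submodule.span_le.2 ?_
    rintro _ ⟨i, j, h, a, w, rfl⟩
    rw [SetLike.mem_coe, LinearMap.mem_ker, LinearMap.flip_apply]
    rcases lt_trichotomy (2 * l) i with hi | hi | hi
    · haveI := subsingleton_complexBetti hX hi
      rw [Subsingleton.elim a 0]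
      simp only [map_zero, LinearMap.zero_apply]
    swap
    · haveI := subsingleton_complexBetti hY (show 2 * m < j by omega)
      rw [Subsingleton.elim w 0]
      simp only [map_zero, LinearMap.zero_apply]
    subst hi
    obtain rfl : j = 2 * m := by omega
    -- `⟨fst^* a ∪ snd^* w, [X ⊗ Y]⟩ = ⟨snd_* fst^* a ∪ w, [Y]⟩ = 0`
    have key := cupPairing_gysinMap (μY := μ hXY) (hμ hY)
      (AlgPoints.mapContinuous (L := ℂ) (snd X Y)) h (Nat.zero_add (2 * m))
      (complexBetti.map (fst X Y) (2 * l) a) w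
    rw [← complexGysin_eq_gysinMap hXY hY (snd X Y) (show 2 * l + 2 * m = 0 + 2 * (l + m) by omega)
        h (Nat.zero_add _), hall a, map_zero, LinearMap.zero_apply] at key
    exact key.symm
  exact hle (hKXY G₀)

/-- **Gysin base change for the cartesian square `X ⊗ Y —(X ◁ g)→ X ⊗ M` over `g : Y ⟶ M`, from the
Künneth spanning property** (`hK`, Hatcher Thm. 3.15; used for `(X, M)` and `(X, Y)`): for some `c ∈ ℂ`,
`g^* ((snd_{X,M})_* z) = c • (snd_{X,Y})_* ((X ◁ g)^* z)` for all `z ∈ Hᵈ((X ⊗ M)(ℂ))`.  Both sides are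
linear; on a cross product `fst^* a ∪ snd^* b` (`(X ◁ g)^*` of which is `fst^* a ∪ snd^*(g^* b)`) both
vanish for `deg a < 2l` (`complexGysin_cup_map_eq_zero_of_lt`), `a = 0` for `deg a > 2l`, and for
`deg a = 2l` the projection formula gives `(snd_* fst^* a) • g^* b` with the two degree-`0` fibre integrals
over `M` and over `Y` proportional on the line `H^{2l}(X(ℂ))`, the second one non-zero
(`exists_gysin_snd_map_fst_ne_zero`). [cite: Fulton1998, Prop. 1.7 and §16.1]
[cite: FultonYoungTableaux1997, Appendix B §B.1 (5)–(6)] [cite: HatcherAT2002, §3.2 Thm. 3.15] -/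
theorem gysin_baseChange_whiskerLeft_of_kunneth (μ : OrientationFamily)
    (hX : IsSmoothProjective l X) (hY : IsSmoothProjective m Y) (hM : IsSmoothProjective n M)
    (hK : ∀ ⦃m' n' : ℕ⦄ ⦃Y' Z' : SchemeOver ℂ⦄, IsSmoothProjective m' Y' → IsSmoothProjective n' Z' →
      ∀ (k : ℕ) (z : complexBetti (Y' ⊗ Z') k), z ∈ Submodule.span ℂ
        {v | ∃ (i j : ℕ) (h : i + j = k) (b : complexBetti Y' i) (w : complexBetti Z' j),
          v = cupProduct h (complexBetti.map (fst Y' Z') i b) (complexBetti.map (snd Y' Z') j w)})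
    (g : Y ⟶ M) {d d₁ : ℕ} (hd : d + 2 * n = d₁ + 2 * (l + n)) :
    ∃ c : ℂ, ∀ z : complexBetti (X ⊗ M) d,
      complexBetti.map g d₁ (complexGysin μ (IsSmoothProjective.tensor_holds hX hM) hM (snd X M) hd z) =
      c • complexGysin μ (IsSmoothProjective.tensor_holds hX hY) hY (snd X Y)
          (show d + 2 * m = d₁ + 2 * (l + m) by omega) (complexBetti.map (X ◁ g) d z) := by
  have hμ : μ.HasPoincareDuality := OrientationFamily.hasPoincareDuality μ
  have hXM := IsSmoothProjective.tensor_holds hX hM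
  have hXY := IsSmoothProjective.tensor_holds hX hY
  -- the two degree-`0` fibre integrals over `X`
  let α : complexBetti X (2 * l) →ₗ[ℂ] complexBetti M 0 :=
    complexGysin μ hXM hM (snd X M) (show 2 * l + 2 * n = 0 + 2 * (l + n) by omega) ∘ₗ
      (complexBetti.map (fst X M) (2 * l)).hom
  let β : complexBetti X (2 * l) →ₗ[ℂ] complexBetti Y 0 :=
    complexGysin μ hXY hY (snd X Y) (show 2 * l + 2 * m = 0 + 2 * (l + m) by omega) ∘ₗ
      (complexBetti.map (fst X Y) (2 * l)).hom
  obtain ⟨a₁, ha₁⟩ := exists_gysin_snd_map_fst_ne_zero μ hX hY (hK hX hY _)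
  have hβa₁ : β a₁ ≠ 0 := ha₁
  have ha₁0 : a₁ ≠ 0 := by rintro rfl; exact hβa₁ (map_zero β)
  obtain ⟨s, hs⟩ := exists_eq_smul_one μ hM (α a₁)
  obtain ⟨t, ht⟩ := exists_eq_smul_one μ hY (β a₁)
  have ht0 : t ≠ 0 := by rintro rfl; exact hβa₁ (by rw [ht, zero_smul])
  -- on the line `H^{2l}(X(ℂ)) = ℂ · a₁`
  have hline : ∀ a : complexBetti X (2 * l), ∃ r : ℂ,
      α a = (r * s) • singularCohomology.one ℂ (ComplexPoints M) ∧
        β a = (r * t) • singularCohomology.one ℂ (ComplexPoints Y) := by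
    intro a
    obtain ⟨r, rfl⟩ := exists_eq_smul_of_top μ hX ha₁0 a
    exact ⟨r, by rw [map_smul, hs, smul_smul], by rw [map_smul, ht, smul_smul]⟩
  refine ⟨s * t⁻¹, fun z ↦ ?_⟩
  -- both sides are linear in `z`: check on cross products
  let F : complexBetti (X ⊗ M) d →ₗ[ℂ] complexBetti Y d₁ :=
    (complexBetti.map g d₁).hom ∘ₗ complexGysin μ hXM hM (snd X M) hd
  let G : complexBetti (X ⊗ M) d →ₗ[ℂ] complexBetti Y d₁ :=
    (s * t⁻¹) • (complexGysin μ hXY hY (snd X Y) (show d + 2 * m = d₁ + 2 * (l + m) by omega) ∘ₗ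
      (complexBetti.map (X ◁ g) d).hom)
  change F z = G z
  refine LinearMap.eqOn_span (f := F) (g := G) ?_ (hK hX hM d z)
  rintro _ ⟨i, j, hij, a, b, rfl⟩
  change complexBetti.map g d₁ (complexGysin μ hXM hM (snd X M) hd
      (cupProduct hij (complexBetti.map (fst X M) i a) (complexBetti.map (snd X M) j b))) =
    (s * t⁻¹) • complexGysin μ hXY hY (snd X Y) _ (complexBetti.map (X ◁ g) d
      (cupProduct hij (complexBetti.map (fst X M) i a) (complexBetti.map (snd X M) j b)))
  -- `(X ◁ g)^*(fst^* a ∪ snd^* b) = fst^* a ∪ snd^*(g^* b)` on `X ⊗ Y`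
  have e₁ : complexBetti.map (X ◁ g) i (complexBetti.map (fst X M) i a) =
      complexBetti.map (fst X Y) i a := by
    rw [← CategoryTheory.comp_apply, ← complexBetti.map_comp, whiskerLeft_fst]
  have e₂ : complexBetti.map (X ◁ g) j (complexBetti.map (snd X M) j b) =
      complexBetti.map (snd X Y) j (complexBetti.map g j b) := by
    rw [← CategoryTheory.comp_apply, ← complexBetti.map_comp, whiskerLeft_snd, complexBetti.map_comp,
      CategoryTheory.comp_apply]
  rw [cupProduct_map, e₁, e₂]
  rcases lt_trichotomy i (2 * l) with hi | hi | hi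
  · -- below the top degree of `X` both sides vanish
    have hji : j + i = d := by omega
    have eL : complexGysin μ hXM hM (snd X M) hd
        (cupProduct hij (complexBetti.map (fst X M) i a) (complexBetti.map (snd X M) j b)) = 0 := by
      rw [cupProduct_gradedComm_holds ℂ _ hij hji, map_smul,
        complexGysin_cup_map_eq_zero_of_lt hXM hM (snd X M) hji hd (by omega) b, smul_zero]
    have eR : complexGysin μ hXY hY (snd X Y) (show d + 2 * m = d₁ + 2 * (l + m) by omega)
        (cupProduct hij (complexBetti.map (fst X Y) i a)
          (complexBetti.map (snd X Y) j (complexBetti.map g j b))) = 0 := by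
      rw [cupProduct_gradedComm_holds ℂ _ hij hji, map_smul,
        complexGysin_cup_map_eq_zero_of_lt hXY hY (snd X Y) hji _ (by omega), smul_zero]
    rw [eL, eR, map_zero, smul_zero]
  swap
  · haveI := subsingleton_complexBetti hX hi
    rw [Subsingleton.elim a 0]
    simp only [map_zero, LinearMap.zero_apply, smul_zero]
  subst hi
  obtain rfl : j = d₁ := by omega
  obtain ⟨r, hαa, hβa⟩ := hline a
  have hji : j + 2 * l = d := by omega
  have hsign : ((-1 : ℂ) ^ (2 * l * j)) = 1 := ((even_two_mul l).mul_right j).neg_one_pow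
  -- left: `g^* snd_*(fst^* a ∪ snd^* b) = g^*(b ∪ snd_* fst^* a) = (r s) • g^* b`
  have eL : complexGysin μ hXM hM (snd X M) hd
      (cupProduct hij (complexBetti.map (fst X M) (2 * l) a) (complexBetti.map (snd X M) j b)) =
      (r * s) • b := by
    rw [cupProduct_gradedComm_holds ℂ _ hij hji, hsign, one_smul,
      complexGysin_cup hμ hXM hM (snd X M) hji hd (show 2 * l + 2 * n = 0 + 2 * (l + n) by omega)
        (Nat.add_zero _) b]
    change cupProduct _ b (α a) = _
    rw [hαa, map_smul, cupProduct_one]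
  -- right: `snd_*(fst^* a ∪ snd^* g^* b) = g^* b ∪ snd_* fst^* a = (r t) • g^* b`
  have eR : complexGysin μ hXY hY (snd X Y) (show d + 2 * m = j + 2 * (l + m) by omega)
      (cupProduct hij (complexBetti.map (fst X Y) (2 * l) a)
        (complexBetti.map (snd X Y) j (complexBetti.map g j b))) =
      (r * t) • complexBetti.map g j b := by
    rw [cupProduct_gradedComm_holds ℂ _ hij hji, hsign, one_smul,
      complexGysin_cup hμ hXY hY (snd X Y) hji _ (show 2 * l + 2 * m = 0 + 2 * (l + m) by omega)
        (Nat.add_zero _) _]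
    change cupProduct _ _ (β a) = _
    rw [hβa, map_smul, cupProduct_one]
  rw [eL, map_smul, eR, smul_smul, mul_comm r t, ← mul_assoc, inv_mul_cancel_right₀ ht0, mul_comm]

/-- `⟨a ∪ b, [T]⟩ = ⟨b ∪ a, [T]⟩ for `deg a` even (graded commutativity). [cite: HatcherAT2002, §3.2 Thm. 3.11] -/
theorem cupPairing_comm_of_even {T : Type u} [TopologicalSpace T] {N p q : ℕ}
    (ν : HomologicalOrientation ℂ T N) (h : p + q = N) (h' : q + p = N) (hp : Even p)
    (a : singularCohomology ℂ ℂ T p) (b : singularCohomology ℂ ℂ T q) :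
    cupPairing ν h a b = cupPairing ν h' b a := by
  rw [cupPairing_apply, cupPairing_apply, cupProduct_gradedComm_holds ℂ T h h' a b, map_smul,
    LinearMap.smul_apply, (hp.mul_right q).neg_one_pow, one_smul]

/-- **The two actions of a correspondence are mutually transposed for the Poincaré pairings** (even
degrees `2a, 2b, 2e`, `a + b + e = l + m`): `⟨fst_*(snd^* y ∪ γ) ∪ x, [X(ℂ)]⟩ = ⟨y ∪ snd_*(fst^* x ∪ γ), [Y(ℂ)]⟩`
— `cupPairing_gysinMap` for `fst` and for `snd` reduces both sides to `⟨snd^* y ∪ γ ∪ fst^* x, [X ⊗ Y]⟩` up to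
associativity and graded commutativity of `∪`. [cite: FultonYoungTableaux1997, Appendix B §B.1 (5)–(6)]
[cite: Fulton1998, §16.1] -/
theorem cupPairing_gysin_fst_eq_cupPairing_gysin_snd (μ : OrientationFamily)
    (hX : IsSmoothProjective l X) (hY : IsSmoothProjective m Y)
    {a b e s s' t u : ℕ} (hs : 2 * a + 2 * e = s) (hA : s + 2 * l = t + 2 * (l + m))
    (ht : t + 2 * b = 2 * l) (hs' : 2 * b + 2 * e = s') (hB : s' + 2 * m = u + 2 * (l + m))
    (hu : 2 * a + u = 2 * m) (γ : complexBetti (X ⊗ Y) (2 * e)) (y : complexBetti Y (2 * a))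
    (x : complexBetti X (2 * b)) :
    cupPairing (μ hX) ht
        (complexGysin μ (IsSmoothProjective.tensor_holds hX hY) hX (fst X Y) hA
          (cupProduct hs (complexBetti.map (snd X Y) (2 * a) y) γ)) x =
      cupPairing (μ hY) hu y
        (complexGysin μ (IsSmoothProjective.tensor_holds hX hY) hY (snd X Y) hB
          (cupProduct hs' (complexBetti.map (fst X Y) (2 * b) x) γ)) := by
  have hμ : μ.HasPoincareDuality := OrientationFamily.hasPoincareDuality μ
  have hXY := IsSmoothProjective.tensor_holds hX hY
  -- left: to a pairing on `X ⊗ Y`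
  rw [complexGysin_eq_gysinMap hXY hX (fst X Y) hA (q := 2 * b) (by omega) ht,
    cupPairing_gysinMap (hμ hX) _ (show s + 2 * b = 2 * (l + m) by omega) ht]
  -- right: flip, then to a pairing on `X ⊗ Y`
  rw [cupPairing_comm_of_even (μ hY) hu (show u + 2 * a = 2 * m by omega) (even_two_mul a) y,
    complexGysin_eq_gysinMap hXY hY (snd X Y) hB (q := 2 * a) (by omega) (by omega),
    cupPairing_gysinMap (hμ hY) _ (show s' + 2 * a = 2 * (l + m) by omega)
      (show u + 2 * a = 2 * m by omega)]
  -- compare the two triple cup products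
  have h₁ : ((-1 : ℂ) ^ (2 * a * s')) = 1 := ((even_two_mul a).mul_right s').neg_one_pow
  have h₂ : ((-1 : ℂ) ^ (2 * e * (2 * b))) = 1 := ((even_two_mul e).mul_right (2 * b)).neg_one_pow
  rw [cupPairing_apply, cupPairing_apply,
    cupProduct_assoc hs (show 2 * e + 2 * b = s' by omega) (show s + 2 * b = 2 * (l + m) by omega)
      (show 2 * a + s' = 2 * (l + m) by omega),
    cupProduct_gradedComm_holds ℂ _ (show 2 * a + s' = 2 * (l + m) by omega)
      (show s' + 2 * a = 2 * (l + m) by omega),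
    cupProduct_gradedComm_holds ℂ _ (show 2 * e + 2 * b = s' by omega) hs', h₁, h₂, one_smul, one_smul]

end Summit.HodgeConjecture.HodgeConjecture.Theorems.NikulinTwinTransport.MixedClassTransfer

end

open scoped Manifold ContDiff
open CategoryTheory MonoidalCategory
open Literature.AlgebraicGeometry Literature.AlgebraicGeometry.HodgeTheory
open Literature.AlgebraicGeometry.Surfaces Literature.AlgebraicGeometry.Motives
open Literature.AlgebraicTopology.SingularHomology
open Literature.Geometry.Hyperkaehler Literature.Geometry.Kaehler
open Literature.NumberTheory.Transcendental (DeRhamIsoFamily)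
open Summit.HodgeConjecture.HodgeConjecture.Theorems
open Summit.HodgeConjecture.HodgeConjecture.Theorems.NikulinTwinTransport

namespace Summit.HodgeConjecture.HodgeConjecture.Cruxes.NikulinSerreCarrier.ModularTwinAddress

/-- **Mixed-class transfer** (registered stub of the line `modular-twin-address`): the address equation
`g^*(snd_*(fst^*(Ψ y) ∪ ch₂ 𝓔)) = (−2m) • y`, the bijective 2-similitude `Ψ` and Künneth spanning give
`fst_*(snd^* y ∪ ch₂((X ◁ g)^*𝓔)) = (−m′) • Ψ y` on `H²(Y)` with `m′ ≠ 0` (base change for the square over `g`,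
transpose of the correspondence, perfectness of the Poincaré pairing; see the module docstring).
[cite: Fulton1998, §16.1] [cite: FultonYoungTableaux1997, Appendix B §B.1 (5)–(6)]
[cite: HatcherAT2002, §3.3 Prop. 3.38] -/
theorem stub_mixedClassTransfer :
    ∀ (μ : OrientationFamily), μ.HasPoincareDuality →
      (∀ ⦃m' n' : ℕ⦄ ⦃Y' Z' : SchemeOver ℂ⦄, IsSmoothProjective m' Y' → IsSmoothProjective n' Z' →
        ∀ (k : ℕ) (z : complexBetti (Y' ⊗ Z') k), z ∈ Submodule.span ℂ
          {v | ∃ (i j : ℕ) (h : i + j = k) (b : complexBetti Y' i) (w : complexBetti Z' j),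
            v = cupProduct h (complexBetti.map (SemiCartesianMonoidalCategory.fst Y' Z') i b)
              (complexBetti.map (SemiCartesianMonoidalCategory.snd Y' Z') j w)}) →
      ∀ (C : ChernCharacterBetti) (k : ℕ) (X Y Mv : SchemeOver ℂ) (hX : IsSmoothProjective 2 X)
        (hY : IsSmoothProjective 2 Y) (hMv : IsSmoothProjective k Mv)
        (pX : complexBetti X (2 * 2)) (pY : complexBetti Y (2 * 2)),
        (IsIntegralClass pX ∧ ∀ q : complexBetti X (2 * 2), IsIntegralClass q → ∃ n : ℤ, q = n • pX) →
        (IsIntegralClass pY ∧ ∀ q : complexBetti Y (2 * 2), IsIntegralClass q → ∃ n : ℤ, q = n • pY) →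
      ∀ (Ψ : complexBetti Y (2 * 1) →ₗ[ℂ] complexBetti X (2 * 1)),
        (∀ (x y : complexBetti Y (2 * 1)) (a : ℂ),
          cupProduct (rfl : 2 * 1 + 2 * 1 = 2 * 2) x y = a • pY →
          cupProduct (rfl : 2 * 1 + 2 * 1 = 2 * 2) (Ψ x) (Ψ y) = ((2 : ℂ) * a) • pX) →
        Function.Bijective Ψ →
      ∀ (𝓔 : (X ⊗ Mv).left.Modules) (g : Y ⟶ Mv) (m : ℂ), IsVectorBundle 𝓔 → m ≠ 0 →
        (∀ y : complexBetti Y (2 * 1),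
            complexBetti.map g (2 * 1)
              (complexGysin μ (IsSmoothProjective.tensor_holds hX hMv) hMv
                (SemiCartesianMonoidalCategory.snd X Mv)
                (by omega : 2 * 3 + 2 * k = 2 * 1 + 2 * (2 + k))
                (cupProduct (rfl : 2 * 1 + 2 * 2 = 2 * 3)
                  (complexBetti.map (SemiCartesianMonoidalCategory.fst X Mv) (2 * 1) (Ψ y))
                  (C.ch (X ⊗ Mv) 𝓔 2))) =
            (-(2 * m)) • y) →
        ∃ m' : ℂ, m' ≠ 0 ∧ ∀ y : complexBetti Y (2 * 1),
            complexGysin μ (IsSmoothProjective.tensor_holds hX hY) hX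
              (SemiCartesianMonoidalCategory.fst X Y)
              (rfl : 2 * 1 + 2 * 2 + 2 * 2 = 2 * 1 + 2 * (2 + 2))
              (cupProduct (rfl : 2 * 1 + 2 * 2 = 2 * 1 + 2 * 2)
                (complexBetti.map (SemiCartesianMonoidalCategory.snd X Y) (2 * 1) y)
                (C.ch (X ⊗ Y) ((AlgebraicGeometry.Scheme.Modules.pullback (X ◁ g).left).obj 𝓔) 2)) =
            (-m') • Ψ y := by
  intro μ _hμ hK C k X Y Mv hX hY hMv pX pY hpX hpY Ψ hΨsim hΨbij 𝓔 g m hE hm haddr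
  have hXY := IsSmoothProjective.tensor_holds hX hY
  have hch : C.ch (X ⊗ Y) ((AlgebraicGeometry.Scheme.Modules.pullback (X ◁ g).left).obj 𝓔) 2 =
      complexBetti.map (X ◁ g) (2 * 2) (C.ch (X ⊗ Mv) 𝓔 2) := (C.map_ch (X ◁ g) 𝓔 hE 2).symm
  rw [hch]
  obtain ⟨c, hc⟩ := MixedClassTransfer.gysin_baseChange_whiskerLeft_of_kunneth μ hX hY hMv hK g
    (d := 2 * 3) (d₁ := 2 * 1) (by omega)
  have hB' : ∀ w : complexBetti Y (2 * 1),
      c • complexGysin μ hXY hY (SemiCartesianMonoidalCategory.snd X Y)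
        (rfl : 2 * 3 + 2 * 2 = 2 * 1 + 2 * (2 + 2))
        (cupProduct (rfl : 2 * 1 + 2 * 2 = 2 * 3)
          (complexBetti.map (SemiCartesianMonoidalCategory.fst X Y) (2 * 1) (Ψ w))
          (complexBetti.map (X ◁ g) (2 * 2) (C.ch (X ⊗ Mv) 𝓔 2))) = (-(2 * m)) • w := by
    intro w
    have e₁ : complexBetti.map (X ◁ g) (2 * 1)
        (complexBetti.map (SemiCartesianMonoidalCategory.fst X Mv) (2 * 1) (Ψ w)) =
        complexBetti.map (SemiCartesianMonoidalCategory.fst X Y) (2 * 1) (Ψ w) := by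
      rw [← CategoryTheory.comp_apply, ← complexBetti.map_comp, CartesianMonoidalCategory.whiskerLeft_fst]
    rw [← haddr w, hc, cupProduct_map, e₁]
  by_cases hc0 : c = 0
  · have hY0 : ∀ w : complexBetti Y (2 * 1), w = 0 := fun w ↦ by
      have h := hB' w
      rw [hc0, zero_smul] at h
      exact (smul_eq_zero.1 h.symm).resolve_left (neg_ne_zero.2 (mul_ne_zero two_ne_zero hm))
    refine ⟨1, one_ne_zero, fun y ↦ ?_⟩
    rw [hY0 y]
    simp only [map_zero, LinearMap.zero_apply, smul_zero]
  have hgen : ∀ {Z : SchemeOver ℂ} {p : complexBetti Z (2 * 2)}, IsSmoothProjective 2 Z →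
      (∀ q : complexBetti Z (2 * 2), IsIntegralClass q → ∃ n : ℤ, q = n • p) → p ≠ 0 := by
    intro Z p hZ h hp
    obtain ⟨q, hq, hq0⟩ := NikulinSerreCarrier.Negative.OrientationTwist.exists_isIntegralClass_ne_zero_top hZ
    obtain ⟨n, rfl⟩ := h q hq
    exact hq0 (by rw [hp, smul_zero])
  have hpX0 : pX ≠ 0 := hgen hX hpX.2
  have hpY0 : pY ≠ 0 := hgen hY hpY.2
  have heX := MixedClassTransfer.kroneckerPairing_fundamentalClass_ne_zero μ hX hpX0
  have heY := MixedClassTransfer.kroneckerPairing_fundamentalClass_ne_zero μ hY hpY0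
  generalize heXdef : kroneckerPairing ℂ ℂ (ComplexPoints X) (2 * 2) pX (μ hX).fundamentalClass = eX
    at heX
  generalize heYdef : kroneckerPairing ℂ ℂ (ComplexPoints Y) (2 * 2) pY (μ hY).fundamentalClass = eY
    at heY
  refine ⟨m * eY * c⁻¹ * eX⁻¹,
    mul_ne_zero (mul_ne_zero (mul_ne_zero hm heY) (inv_ne_zero hc0)) (inv_ne_zero heX), fun y ↦ ?_⟩
  rw [← sub_eq_zero]
  refine eq_zero_of_forall_cupPairing_eq_zero μ hX (rfl : 2 * 1 + 2 * 1 = 2 * 2) fun x' ↦ ?_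
  obtain ⟨w, rfl⟩ := hΨbij.2 x'
  obtain ⟨aw, haw⟩ := exists_eq_smul_of_top μ hY hpY0 (cupProduct (rfl : 2 * 1 + 2 * 1 = 2 * 2) y w)
  have hΨyw := hΨsim y w aw haw
  have hB'w : complexGysin μ hXY hY (SemiCartesianMonoidalCategory.snd X Y)
      (rfl : 2 * 3 + 2 * 2 = 2 * 1 + 2 * (2 + 2))
      (cupProduct (rfl : 2 * 1 + 2 * 2 = 2 * 3)
        (complexBetti.map (SemiCartesianMonoidalCategory.fst X Y) (2 * 1) (Ψ w))
        (complexBetti.map (X ◁ g) (2 * 2) (C.ch (X ⊗ Mv) 𝓔 2))) = (c⁻¹ * (-(2 * m))) • w := by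
    rw [← smul_smul, ← hB' w, smul_smul, inv_mul_cancel₀ hc0, one_smul]
  rw [map_sub, LinearMap.sub_apply, map_smul, LinearMap.smul_apply,
    MixedClassTransfer.cupPairing_gysin_fst_eq_cupPairing_gysin_snd μ hX hY (a := 1) (b := 1) (e := 2)
      (s := 2 * 1 + 2 * 2) (s' := 2 * 3) (t := 2 * 1) (u := 2 * 1) rfl rfl rfl rfl rfl rfl _ y (Ψ w),
    hB'w, map_smul, cupPairing_apply, cupPairing_apply, haw, hΨyw, map_smul, map_smul,
    LinearMap.smul_apply, LinearMap.smul_apply, heXdef, heYdef]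
  simp only [smul_eq_mul]
  linear_combination (2 * m * aw * eY * c⁻¹) * inv_mul_cancel₀ heX

end Summit.HodgeConjecture.HodgeConjecture.Cruxes.NikulinSerreCarrier.ModularTwinAddress
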